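import Mathlib
import HarnessLib
import Literature.Analysis.Complex.LaplaceDecaySupportSignedPair
import Literature.Analysis.SpecialFunctions.BesselKLaplaceMeasure
import Summits.AtomisticToContinuum.Crystallization.Theorems.HolmgrenBoyleLindHalfSpaceUniqueContinuationShellLaplace
import Summits.AtomisticToContinuum.Crystallization.Theorems.HolmgrenBoyleLindHalfSpaceUniqueContinuationVerticalModeLaplace

/-!
# Route `HolmgrenBoyleLind`: Lennard-Jones force fields of separated sources, part 18a —
shell peeling tools I: decay form of the one-shell uniqueness lemma, sizes of shells and modes

Support file for the crux item stmt-AtomisticToContinuum-6075 (`HalfSpaceUniqueContinuation`, line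
`registered`, layered core, THICK-CLASS PEELING; infrastructure written by a stub-worker of lead c3).
ABSTRACT SETTING of part 12 (no geometry): sources `q` with weights `‖θ q‖ ≤ 1` and heights
`y q ≥ 0` with window count `N`. When the Fourier modes of a layer sum are peeled off shell by
shell, a shell is only known to be as small as the NEXT shell, `O(e^{-κX})` in the depth `X` with
`κ` beyond its own rate `2πr`; this file provides the corresponding tools:
* `hbl_tsum_eq_zero_of_fibres` — regrouping a layer sum by its finite height fibres: vanishing
  fibre sums `∑_{y q = η} θ q = 0` force `∑_q θ q F(y q) = 0`;
* `hbl_shell_fibres_eq_zero_of_laplace_decay` — PEELING ONE SHELL, decay form of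
  `hbl_shell_fibres_eq_zero_of_laplace_eq`: `‖α L[σ m₁](X) − β L[σ m₂](X)‖ ≤ C e^{-κX}` for large
  `X` with `κ > c` (`mᵢ = besselLaplaceMeasure νᵢ pᵢ c t₀`, endpoint domination, `α ≠ 0`) forces
  the fibres to vanish (`Literature.Analysis.Complex.eqOn_zero_of_laplace_exp_decay_signedPair` on
  `(c, c + ε) ⊆ (-∞, κ]`);
* `hbl_hasSum_shellProfile`, `hbl_norm_shellLaplace_le`, `hbl_peel_exists_mode_bound` — the
  two-kernel shell profile as `a I₁ + b I₂`, the size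
  `‖L[σ m](X)‖ ≤ e^{-c(X - t₀)} N e^{c}(1 − e^{-c})⁻¹ m(ℝ)` of one shell Laplace integral, and a bound
  `D e^{-2πr' X} e^{-2πr}` for every mode of radius `r ≥ r'`, uniform in the weights.
All `[folklore]`; nothing here closes an item.
-/

noncomputable section

namespace Summit.AtomisticToContinuum.Crystallization.Theorems.HolmgrenBoyleLind

open scoped BigOperators Topology
open MeasureTheory Filter Set Literature.Analysis.SpecialFunctions

/-! ## Regrouping by height fibres -/

/-- **Regrouping a layer sum by its height fibres.** If the heights are locally finite, the
layer sum `∑_q θ q F(y q)` converges and every fibre sum `∑_{q : y q = η} θ q` vanishes, then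
`∑_q θ q F(y q) = 0` (`HasSum.tsum_fiberwise`; each fibre is finite). [folklore] -/
theorem hbl_tsum_eq_zero_of_fibres {ι : Type*} {y : ι → ℝ}
    (hfin : ∀ Y : ℝ, {q : ι | y q ≤ Y}.Finite) {θ : ι → ℂ} (F : ℝ → ℂ)
    (hs : Summable fun q => θ q * F (y q))
    (hfib : ∀ η : ℝ, ∑ q ∈ (hfin η).toFinset with y q = η, θ q = 0) :
    ∑' q, θ q * F (y q) = 0 := by
  have h := hs.hasSum.tsum_fiberwise y
  have hf : ∀ η : ℝ, ∑' b : y ⁻¹' {η}, θ b * F (y b) = 0 := by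
    intro η
    have hset : (y ⁻¹' {η} : Set ι) = ↑((hfin η).toFinset.filter fun q => y q = η) := by
      ext q
      simp only [mem_preimage, mem_singleton_iff, Finset.coe_filter, Finite.mem_toFinset,
        mem_setOf_eq]
      exact ⟨fun h => ⟨h.le, h⟩, fun h => h.2⟩
    rw [tsum_congr_set_coe (fun b => θ b * F (y b)) hset]
    refine (Finset.tsum_subtype' _ (fun b => θ b * F (y b))).trans ?_
    calc ∑ q ∈ (hfin η).toFinset with y q = η, θ q * F (y q)
        = ∑ q ∈ (hfin η).toFinset with y q = η, θ q * F η :=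
          Finset.sum_congr rfl fun q hq => by rw [(Finset.mem_filter.1 hq).2]
      _ = 0 := by rw [← Finset.sum_mul, hfib η, zero_mul]
  simp only [hf] at h
  exact h.unique hasSum_zero ▸ rfl

section Shell

variable {ι : Type*} [Countable ι] {θ : ι → ℂ} {y : ι → ℝ} {N : ℕ}

/-! ## One shell: decay form of the peeling lemma, profile and size -/

/-- **Peeling one shell, decay form.** Let `mᵢ = besselLaplaceMeasure νᵢ pᵢ c t₀` (`pᵢ, c, t₀ > 0`)
with `m₂` negligible against `m₁` at the endpoint. If the signed shell profile decays FASTER THAN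
THE SHELL, `‖α ∫ e^{-l(X - t₀)} σ(max l c) dm₁ − β ∫ e^{-l(X - t₀)} σ(max l c) dm₂‖ ≤ C e^{-κ X}` for
`X ≥ X₁` with `κ > c`, `α ≠ 0`, `σ(l) = ∑_q θ q e^{-l y_q}`, then every height fibre
`∑_{q : y_q = η} θ q` vanishes (`eqOn_zero_of_laplace_exp_decay_signedPair` on `(c, c + ε')`,
`ε' = min ε (κ - c)`, then `hbl_shell_fibres_eq_zero_of_eqOn`). [folklore] -/
theorem hbl_shell_fibres_eq_zero_of_laplace_decay (hθ : ∀ q, ‖θ q‖ ≤ 1) (hy : ∀ q, 0 ≤ y q)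
    (hN : ∀ j : ℕ, {q : ι | (j : ℝ) ≤ y q ∧ y q ≤ j + 1}.encard ≤ N) (ν₁ ν₂ : ℝ) {p₁ p₂ c t₀ : ℝ}
    (hp₁ : 0 < p₁) (hp₂ : 0 < p₂) (hc : 0 < c) (ht₀ : 0 < t₀)
    (hdom : ∀ κ : ℝ, 0 < κ → ∃ ε : ℝ, 0 < ε ∧ ∀ A : Set ℝ, MeasurableSet A → A ⊆ Ioo c (c + ε) →
      besselLaplaceMeasure ν₂ p₂ c t₀ A ≤ ENNReal.ofReal κ * besselLaplaceMeasure ν₁ p₁ c t₀ A)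
    {α β : ℂ} (hα : α ≠ 0) {κ C X₁ : ℝ} (hκ : c < κ)
    (hdecay : ∀ X : ℝ, X₁ ≤ X →
      ‖α * (∫ l, Complex.exp (-((l * (X - t₀) : ℝ) : ℂ)) *
          (∑' q, θ q * Complex.exp (-((y q : ℂ) * ((max l c : ℝ) : ℂ))))
            ∂(besselLaplaceMeasure ν₁ p₁ c t₀)) -
        β * (∫ l, Complex.exp (-((l * (X - t₀) : ℝ) : ℂ)) *
          (∑' q, θ q * Complex.exp (-((y q : ℂ) * ((max l c : ℝ) : ℂ))))
            ∂(besselLaplaceMeasure ν₂ p₂ c t₀))‖ ≤ C * Real.exp (-κ * X))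
    (η : ℝ) : ∑ q ∈ (hbl_shell_heights_finite hN hy η).toFinset with y q = η, θ q = 0 := by
  -- adapted from `hbl_shell_fibres_eq_zero_of_laplace_eq` (…ShellLaplace): genuine decay bound
  obtain ⟨hσ, hσM⟩ := hbl_continuous_shellSeries_max hθ hy hN hc
  haveI := isFiniteMeasure_besselLaplaceMeasure ν₁ hp₁ hc ht₀
  haveI := isFiniteMeasure_besselLaplaceMeasure ν₂ hp₂ hc ht₀
  have h₁ : besselLaplaceMeasure ν₁ p₁ c t₀ (Iio 0) = 0 :=
    measure_mono_null (Iio_subset_Iio hc.le) (besselLaplaceMeasure_Iio ν₁ hp₁ hc ht₀)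
  have h₂ : besselLaplaceMeasure ν₂ p₂ c t₀ (Iio 0) = 0 :=
    measure_mono_null (Iio_subset_Iio hc.le) (besselLaplaceMeasure_Iio ν₂ hp₂ hc ht₀)
  -- the admissible ratio `q`: `‖β‖ q < ‖α‖`
  have hα' : 0 < ‖α‖ := norm_pos_iff.2 hα
  have hq0 : 0 < ‖α‖ / (2 * (‖β‖ + 1)) := div_pos hα' (by positivity)
  have hαβ : ‖β‖ * (‖α‖ / (2 * (‖β‖ + 1))) < ‖α‖ := by
    rw [mul_div_assoc', div_lt_iff₀ (by positivity)]
    nlinarith [norm_nonneg β]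
  obtain ⟨ε, hε, hdomε⟩ := hdom _ hq0
  -- shrink the interval below `κ`
  have hε' : 0 < min ε (κ - c) := lt_min hε (sub_pos.2 hκ)
  have hb : c + min ε (κ - c) ≤ κ := by have := min_le_right ε (κ - c); linarith
  -- the signed Laplace transform in the unshifted variable
  have hdecay' : ∀ X : ℝ, X₁ - t₀ ≤ X →
      ‖α * (∫ l, Complex.exp (-(l : ℂ) * X) *
          (∑' q, θ q * Complex.exp (-((y q : ℂ) * ((max l c : ℝ) : ℂ))))
            ∂(besselLaplaceMeasure ν₁ p₁ c t₀)) -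
        β * (∫ l, Complex.exp (-(l : ℂ) * X) *
          (∑' q, θ q * Complex.exp (-((y q : ℂ) * ((max l c : ℝ) : ℂ))))
            ∂(besselLaplaceMeasure ν₂ p₂ c t₀))‖ ≤
        C * Real.exp (-κ * t₀) * Real.exp (-κ * X) := by
    intro X hX
    have h := hdecay (X + t₀) (by linarith)
    have hint : ∀ μ : Measure ℝ, (∫ l, Complex.exp (-((l * (X + t₀ - t₀) : ℝ) : ℂ)) *
        (∑' q, θ q * Complex.exp (-((y q : ℂ) * ((max l c : ℝ) : ℂ)))) ∂μ) =
          ∫ l, Complex.exp (-(l : ℂ) * X) *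
            (∑' q, θ q * Complex.exp (-((y q : ℂ) * ((max l c : ℝ) : ℂ)))) ∂μ := fun μ => by
      refine integral_congr_ae (ae_of_all _ fun l => ?_)
      dsimp only
      rw [add_sub_cancel_right, Complex.ofReal_mul, neg_mul]
    rw [hint, hint] at h
    refine h.trans_eq ?_
    rw [mul_assoc, ← Real.exp_add]
    ring_nf
  have hvan := Literature.Analysis.Complex.eqOn_zero_of_laplace_exp_decay_signedPair h₁ h₂ hσ hσM
    α β (hc.trans hκ) hdecay' hb hq0.le hαβ
    (fun A hA hAsub => hdomε A hA (hAsub.trans (Ioo_subset_Ioo le_rfl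
      (by linarith [min_le_left ε (κ - c)]))))
    (fun a' b' ha' hb' _ => besselLaplaceMeasure_Ioo_pos ν₁ hp₁ hc ht₀ ha' hb')
  -- on `(c, c + ε')` the regularised series is the series itself
  refine hbl_shell_fibres_eq_zero_of_eqOn hθ hy hN hc hε' (fun l hl => ?_) η
  have h := hvan l hl
  rwa [max_eq_left (le_of_lt hl.1)] at h

/-- **The two-kernel shell profile as a signed pair of Laplace transforms.** For `X > t₀ > 0`,
`r > 0` (`c = 2πr`), real `α, β`: `∑_q θ q (α t_q⁻² J_{ν₁}(t_q) + β t_q⁻⁵ J_{ν₂}(t_q)) = α I₁ + β I₂`,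
`t_q = X + y_q`, `Iᵢ = ∫ e^{-l(X - t₀)} σ(max l c) d(besselLaplaceMeasure νᵢ pᵢ c t₀)`,
`(p₁, p₂) = (2, 5)` (`hbl_hasSum_shell_eq_laplace_univ` twice). [folklore] -/
theorem hbl_hasSum_shellProfile (hθ : ∀ q, ‖θ q‖ ≤ 1) (hy : ∀ q, 0 ≤ y q)
    (hN : ∀ j : ℕ, {q : ι | (j : ℝ) ≤ y q ∧ y q ≤ j + 1}.encard ≤ N) (ν₁ ν₂ α β : ℝ) {r t₀ X : ℝ}
    (hr : 0 < r) (ht₀ : 0 < t₀) (hX : t₀ < X) :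
    HasSum (fun q => θ q *
        ((α * (((X + y q) ^ (-(2 : ℝ)) : ℝ) *
              ∫ u : ℝ, Real.exp (ν₁ * u - 2 * Real.pi * r * (X + y q) * Real.cosh u)) +
          β * (((X + y q) ^ (-(5 : ℝ)) : ℝ) *
              ∫ u : ℝ, Real.exp (ν₂ * u - 2 * Real.pi * r * (X + y q) * Real.cosh u)) : ℝ) : ℂ))
      ((α : ℂ) * (∫ l, Complex.exp (-((l * (X - t₀) : ℝ) : ℂ)) *
            (∑' q, θ q * Complex.exp (-((y q : ℂ) * ((max l (2 * Real.pi * r) : ℝ) : ℂ))))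
          ∂(besselLaplaceMeasure ν₁ 2 (2 * Real.pi * r) t₀)) +
        (β : ℂ) * (∫ l, Complex.exp (-((l * (X - t₀) : ℝ) : ℂ)) *
            (∑' q, θ q * Complex.exp (-((y q : ℂ) * ((max l (2 * Real.pi * r) : ℝ) : ℂ))))
          ∂(besselLaplaceMeasure ν₂ 5 (2 * Real.pi * r) t₀))) := by
  have hc : 0 < 2 * Real.pi * r := by positivity
  have L1 := hbl_hasSum_shell_eq_laplace_univ hθ hy hN ν₁ (p := 2) two_pos hc ht₀ hX
  have L2 := hbl_hasSum_shell_eq_laplace_univ hθ hy hN ν₂ (p := 5) (by norm_num) hc ht₀ hX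
  refine ((L1.mul_left (α : ℂ)).add (L2.mul_left (β : ℂ))).congr_fun fun q => ?_
  push_cast
  ring

omit [Countable ι] in
/-- **Size of one shell.** For `X ≥ t₀ > 0`, `p, c > 0` and `m = besselLaplaceMeasure ν p c t₀`:
`‖∫ e^{-l(X - t₀)} σ(max l c) dm‖ ≤ e^{-c(X - t₀)} · N e^{c} (1 − e^{-c})⁻¹ · t₀^{-p} J_ν(c, t₀)`
(`m` lives on `[c, ∞)`, the regularised series is bounded, total mass
`besselLaplaceMeasure_real_univ`). [folklore] -/
theorem hbl_norm_shellLaplace_le (hθ : ∀ q, ‖θ q‖ ≤ 1) (hy : ∀ q, 0 ≤ y q)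
    (hN : ∀ j : ℕ, {q : ι | (j : ℝ) ≤ y q ∧ y q ≤ j + 1}.encard ≤ N) (ν : ℝ) {p c t₀ X : ℝ}
    (hp : 0 < p) (hc : 0 < c) (ht₀ : 0 < t₀) (hX : t₀ ≤ X) :
    ‖∫ l, Complex.exp (-((l * (X - t₀) : ℝ) : ℂ)) *
        (∑' q, θ q * Complex.exp (-((y q : ℂ) * ((max l c : ℝ) : ℂ))))
          ∂(besselLaplaceMeasure ν p c t₀)‖ ≤
      Real.exp (-(c * (X - t₀))) * (N * Real.exp c / (1 - Real.exp (-c))) *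
        (t₀ ^ (-p) * ∫ u : ℝ, Real.exp (ν * u - c * t₀ * Real.cosh u)) := by
  haveI := isFiniteMeasure_besselLaplaceMeasure ν hp hc ht₀
  obtain ⟨-, hσM⟩ := hbl_continuous_shellSeries_max hθ hy hN hc
  have hae : ∀ᵐ l ∂(besselLaplaceMeasure ν p c t₀), c ≤ l := by
    filter_upwards [measure_eq_zero_iff_ae_notMem.1 (besselLaplaceMeasure_Iio ν hp hc ht₀)]
      with l hl using not_lt.1 hl
  rw [← besselLaplaceMeasure_real_univ ν hp hc ht₀]
  refine norm_integral_le_of_norm_le_const ?_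
  filter_upwards [hae] with l hl
  rw [norm_mul, ← Complex.ofReal_neg, Complex.norm_exp_ofReal]
  exact mul_le_mul (Real.exp_le_exp.2 (neg_le_neg (mul_le_mul_of_nonneg_right hl
    (sub_nonneg.2 hX)))) (hσM l) (norm_nonneg _) (Real.exp_pos _).le

/-- **Uniform size of one mode.** Given a minimal radius `r' > 0`, `t₀ > 0` and `T ≥ t₀ + 3` there
is `D ≥ 0` with: for all weights `‖θ q‖ ≤ 1`, radii `r ≥ r'`, depths `X ≥ T` and real coefficients
`|α|, |β| ≤ B e^{r}`, `‖∑_q θ q (α t_q⁻² J_{ν₁}(2πr, t_q) + β t_q⁻⁵ J_{ν₂}(2πr, t_q))‖ ≤ D e^{-2πr' X} e^{-2πr}`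
(`t_q = X + y_q`, `J_ν(c, t) = ∫ e^{νu − ct cosh u} du`): the profile is `α I₁ + β I₂`, each `Iᵢ` is
bounded by `hbl_norm_shellLaplace_le`, the constants are monotone in the shell parameter
(`integral_exp_sub_mul_cosh_le_exp_mul`), and `r + 2πr t₀ + 4πr ≤ 2πr T`. [folklore] -/
theorem hbl_peel_exists_mode_bound (hy : ∀ q, 0 ≤ y q)
    (hN : ∀ j : ℕ, {q : ι | (j : ℝ) ≤ y q ∧ y q ≤ j + 1}.encard ≤ N) (ν₁ ν₂ : ℝ) {r' t₀ T : ℝ}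
    (B : ℝ) (hr' : 0 < r') (ht₀ : 0 < t₀) (hT : t₀ + 3 ≤ T) :
    ∃ D : ℝ, 0 ≤ D ∧ ∀ (θ : ι → ℂ), (∀ q, ‖θ q‖ ≤ 1) → ∀ (α β r X : ℝ), r' ≤ r → T ≤ X →
      |α| ≤ B * Real.exp r → |β| ≤ B * Real.exp r →
      ‖∑' q, θ q *
        ((α * (((X + y q) ^ (-(2 : ℝ)) : ℝ) *
              ∫ u : ℝ, Real.exp (ν₁ * u - 2 * Real.pi * r * (X + y q) * Real.cosh u)) +
          β * (((X + y q) ^ (-(5 : ℝ)) : ℝ) *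
              ∫ u : ℝ, Real.exp (ν₂ * u - 2 * Real.pi * r * (X + y q) * Real.cosh u)) : ℝ) : ℂ)‖ ≤
        D * Real.exp (-(2 * Real.pi * r') * X) * Real.exp (-(2 * Real.pi * r)) := by
  have hc' : 0 < 2 * Real.pi * r' := by positivity
  have h1 : 0 < 1 - Real.exp (-(2 * Real.pi * r')) :=
    sub_pos.2 (Real.exp_lt_one_iff.2 (neg_lt_zero.2 hc'))
  -- the constants at the minimal radius
  set Q' : ℝ := N / (1 - Real.exp (-(2 * Real.pi * r'))) with hQ'
  have hQ'0 : 0 ≤ Q' := div_nonneg (Nat.cast_nonneg N) h1.le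
  set m₁' : ℝ := t₀ ^ (-(2 : ℝ)) * ∫ u : ℝ, Real.exp (ν₁ * u - 2 * Real.pi * r' * t₀ * Real.cosh u)
    with hm₁'
  set m₂' : ℝ := t₀ ^ (-(5 : ℝ)) * ∫ u : ℝ, Real.exp (ν₂ * u - 2 * Real.pi * r' * t₀ * Real.cosh u)
    with hm₂'
  have hm₁'0 : 0 ≤ m₁' := by positivity
  have hm₂'0 : 0 ≤ m₂' := by positivity
  refine ⟨|B| * Q' * (m₁' + m₂') * Real.exp (2 * Real.pi * r' * T), by positivity,
    fun θ hθ α β r X hrr' hX hα hβ => ?_⟩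
  have hr : 0 < r := hr'.trans_le hrr'
  have hc : 0 < 2 * Real.pi * r := by positivity
  have hcc' : 2 * Real.pi * r' ≤ 2 * Real.pi * r := by nlinarith [Real.pi_pos]
  have hXt : t₀ < X := by linarith
  have hα' : |α| ≤ |B| * Real.exp r :=
    hα.trans (mul_le_mul_of_nonneg_right (le_abs_self B) (Real.exp_pos r).le)
  have hβ' : |β| ≤ |B| * Real.exp r :=
    hβ.trans (mul_le_mul_of_nonneg_right (le_abs_self B) (Real.exp_pos r).le)
  rw [(hbl_hasSum_shellProfile hθ hy hN ν₁ ν₂ α β hr ht₀ hXt).tsum_eq]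
  have hI₁ := hbl_norm_shellLaplace_le hθ hy hN ν₁ (p := 2) two_pos hc ht₀ hXt.le
  have hI₂ := hbl_norm_shellLaplace_le hθ hy hN ν₂ (p := 5) (by norm_num) hc ht₀ hXt.le
  -- monotonicity of the constants in the shell parameter
  have hJ : ∀ ν : ℝ, ∫ u : ℝ, Real.exp (ν * u - 2 * Real.pi * r * t₀ * Real.cosh u) ≤
      ∫ u : ℝ, Real.exp (ν * u - 2 * Real.pi * r' * t₀ * Real.cosh u) := fun ν =>
    (integral_exp_sub_mul_cosh_le_exp_mul ν hc' hcc' ht₀).trans (mul_le_of_le_one_left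
      (integral_nonneg fun u => (Real.exp_pos _).le) (Real.exp_le_one_iff.2
      (neg_nonpos.2 (mul_nonneg (sub_nonneg.2 hcc') ht₀.le))))
  have hm₁ : t₀ ^ (-(2 : ℝ)) * (∫ u : ℝ, Real.exp (ν₁ * u - 2 * Real.pi * r * t₀ * Real.cosh u)) ≤
      m₁' := mul_le_mul_of_nonneg_left (hJ ν₁) (Real.rpow_nonneg ht₀.le _)
  have hm₂ : t₀ ^ (-(5 : ℝ)) * (∫ u : ℝ, Real.exp (ν₂ * u - 2 * Real.pi * r * t₀ * Real.cosh u)) ≤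
      m₂' := mul_le_mul_of_nonneg_left (hJ ν₂) (Real.rpow_nonneg ht₀.le _)
  have hQ : (N : ℝ) * Real.exp (2 * Real.pi * r) / (1 - Real.exp (-(2 * Real.pi * r))) ≤
      Q' * Real.exp (2 * Real.pi * r) := by
    rw [hQ', div_mul_eq_mul_div]
    exact div_le_div_of_nonneg_left (by positivity) h1
      (by linarith [Real.exp_le_exp.2 (neg_le_neg hcc')])
  -- the exponent bookkeeping: `r + 2πr t₀ + 4πr ≤ 2πr T` and `X ≥ T`
  have hE : Real.exp r * Real.exp (-(2 * Real.pi * r * (X - t₀))) * Real.exp (2 * Real.pi * r) ≤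
      Real.exp (2 * Real.pi * r' * T) * Real.exp (-(2 * Real.pi * r') * X) *
        Real.exp (-(2 * Real.pi * r)) := by
    rw [← Real.exp_add, ← Real.exp_add, ← Real.exp_add, ← Real.exp_add, Real.exp_le_exp]
    have h1 : r ≤ 2 * Real.pi * r := by nlinarith [Real.pi_gt_three]
    have h2 : 2 * Real.pi * r' * (X - T) ≤ 2 * Real.pi * r * (X - T) :=
      mul_le_mul_of_nonneg_right hcc' (sub_nonneg.2 hX)
    have h3 : 2 * Real.pi * r * (t₀ + 3) ≤ 2 * Real.pi * r * T :=
      mul_le_mul_of_nonneg_left hT hc.le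
    linarith
  set E : ℝ := Real.exp (-(2 * Real.pi * r * (X - t₀))) with hEdef
  have hE0 : 0 ≤ E := (Real.exp_pos _).le
  set Q : ℝ := (N : ℝ) * Real.exp (2 * Real.pi * r) / (1 - Real.exp (-(2 * Real.pi * r))) with hQdef
  refine (norm_add_le _ _).trans ?_
  rw [norm_mul, norm_mul, Complex.norm_real, Complex.norm_real, Real.norm_eq_abs,
    Real.norm_eq_abs]
  refine (add_le_add (mul_le_mul hα' hI₁ (norm_nonneg _) (by positivity))
    (mul_le_mul hβ' hI₂ (norm_nonneg _) (by positivity))).trans ?_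
  calc |B| * Real.exp r * (E * Q * (t₀ ^ (-(2 : ℝ)) *
          ∫ u : ℝ, Real.exp (ν₁ * u - 2 * Real.pi * r * t₀ * Real.cosh u))) +
        |B| * Real.exp r * (E * Q * (t₀ ^ (-(5 : ℝ)) *
          ∫ u : ℝ, Real.exp (ν₂ * u - 2 * Real.pi * r * t₀ * Real.cosh u)))
      ≤ |B| * Real.exp r * (E * (Q' * Real.exp (2 * Real.pi * r)) * m₁') +
        |B| * Real.exp r * (E * (Q' * Real.exp (2 * Real.pi * r)) * m₂') := by
        gcongr
    _ = |B| * Q' * (m₁' + m₂') *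
        (Real.exp r * Real.exp (-(2 * Real.pi * r * (X - t₀))) * Real.exp (2 * Real.pi * r)) := by
        rw [hEdef]; ring
    _ ≤ |B| * Q' * (m₁' + m₂') * (Real.exp (2 * Real.pi * r' * T) *
        Real.exp (-(2 * Real.pi * r') * X) * Real.exp (-(2 * Real.pi * r))) :=
        mul_le_mul_of_nonneg_left hE (by positivity)
    _ = _ := by ring

end Shell

end Summit.AtomisticToContinuum.Crystallization.Theorems.HolmgrenBoyleLind

end
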